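import Summits.BirchSwinnertonDyer.Rank1Residual.P2.CongruentNumberCor515SelmerEight
import Literature.NumberTheory.EllipticCurves.CongruentNumberMonskySelmerParityOdd
import Literature.NumberTheory.EllipticCurves.CongruentNumberMonskySelmerParityEven
import HarnessLib

/-!
# Cell `bsd-monsky`, route A: MONSKY'S REMARK (2) «PRECISELY» — Cor. 5.15's twelve families are EXACTLY the square-free `N`
# with at most two odd prime factors and `#Sel⁽²⁾(E_N/ℚ) = 8` (`S̄ = ℤ/2`)

HONEST FRAMING (cell `bsd-monsky`, run/shared/lean/pub/bsd-monsky/; README §1): ONE theorem on ONE explicit infinite family at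
the prime `2`; nothing is booked by this file; no mark moved. Sequel to `P2/CongruentNumberCor515SelmerEight.lean` (the direction
«Cor. 5.15 ⟹ `#Sel⁽²⁾ = 8`» on all twelve families). Monsky 1990, p. 67 Remark (2): «The very patient reader may verify that
`S̄ = ℤ/2` and `S̄* = (0)` PRECISELY when we are in one of the 16 cases listed in Theorems 5.13 and 5.14» — for `D` with one or two
prime factors. THIS FILE proves the `N`-side of «precisely»: for `N` a product of at most two distinct odd primes, possibly times `2`,
  **`IsCor515Family N ⟺ #Sel⁽²⁾(E_N/ℚ) = 8`**
(`isCor515Family_iff_card_selmerGroup_two_eq_eight`; shape by shape `isCor515Family_prime_iff`, `…_two_mul_prime_iff`,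
`…_mul_iff`, `…_two_mul_mul_iff`). The root-number condition `N ≡ 5, 6, 7 (mod 8)` is NOT assumed: Monsky's PARITY THEOREM
(prover-B g16, `even_monskySelmerRank{Odd,Even}_iff`) makes `s(N) = 1` impossible for `N ≡ 1, 2, 3 (mod 8)`, so `#Sel⁽²⁾ = 8`
alone forces the residue class; the symbol conditions `(p₁/q) = −1` come from the exceptional rows `s = 3`
(Remark (1), `…Cor515Remarks.lean`). Consequence (`isCongruentNumber_iff_primaryComponent_sha_two_eq_bot_of_card_selmerGroup_two_eq_eight_shape`):
on this locus «`N` congruent ⟺ `Ш(E_N)[2^∞] = 0`» — Monsky's «rank exactly one» is, for every such `N`, the statement that `N`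
is a congruent number. UNCONDITIONAL; nothing asserted beyond kernel theorems; no new named fact; no `_holds`.

References: [Monsky1990MockHeegner] Cor. 5.15 (p. 66), Remarks (1)–(2) (pp. 66–67), Thms. 5.13–5.14 (pp. 65–66);
[HeathBrown1994SelmerCongruentII] §1 (typescript p. 6 L26–L28), Appendix (Monsky) pp. 38–41 (the Theorem p. 38 L5–L7);
[IrelandRosen1990] Ch. 5 §2 Thm. 1; [SilvermanAEC2009] Thm. X.4.2; [TopYui2008Congruent] Prop. 3.3.
-/

noncomputable section

open scoped Classical

open WeierstrassCurve Literature.NumberTheory.EllipticCurves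
  Literature.NumberTheory.EllipticCurves.HeathBrown1994
  Literature.NumberTheory.EllipticCurves.Monsky1990
  Literature.NumberTheory.EllipticCurves.MonskySelmerParity
  Literature.NumberTheory.EllipticCurves.SelmerEightShaTwo

set_option autoImplicit false

namespace Summit.BirchSwinnertonDyer.Rank1Residual.P2

/-! ## §1 Reading `s(N) = 1` off `#Sel⁽²⁾(E_N/ℚ) = 8` (Monsky's formula with equality) -/

/-- `#Sel⁽²⁾(E_{pq}) = 8 ⟹ s(pq) = 1` for distinct odd primes (the tuple `![p, q]`).
[cite: HeathBrown1994SelmerCongruentII, Appendix (Monsky), typescript p. 39 L10–L33] -/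
theorem monskySelmerRankOdd_pair_eq_one_of_card_eight {p q : ℕ} (hp : p.Prime) (hq : q.Prime) (hp2 : p ≠ 2)
    (hq2 : q ≠ 2) (hne : p ≠ q) (h8 : Nat.card ((congruentNumberCurve (p * q)).selmerGroup 2) = 8) :
    monskySelmerRankOdd ![p, q] = 1 := by
  have ht : ∀ i, (![p, q] i).Prime := fun i => by fin_cases i <;> assumption
  have ht2 : ∀ i, (![p, q] i) ≠ 2 := fun i => by fin_cases i <;> assumption
  have hinj : Function.Injective ![p, q] := by
    intro i j hij
    fin_cases i <;> fin_cases j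
    · rfl
    · exact absurd hij hne
    · exact absurd hij.symm hne
    · rfl
  have key : ∀ {M : ℕ}, (∏ i, (![p, q] : Fin 2 → ℕ) i) = M →
      Nat.card ((congruentNumberCurve M).selmerGroup 2) = 2 ^ (2 + monskySelmerRankOdd ![p, q]) := by
    intro M hM
    subst hM
    exact CongruentNumberOddMonskySelmerExact.card_selmerGroup_two_eq_pow ht ht2 hinj
  have hprod : (∏ i, (![p, q] : Fin 2 → ℕ) i) = p * q := by rw [Fin.prod_univ_two]; rfl
  have h' : 2 ^ (2 + monskySelmerRankOdd ![p, q]) = 2 ^ 3 :=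
    ((key hprod).symm.trans h8).trans (by norm_num)
  have := Nat.pow_right_injective le_rfl h'
  omega

/-- `#Sel⁽²⁾(E_{2pq}) = 8 ⟹ s(2pq) = 1` for distinct odd primes (the tuple `![p, q]`).
[cite: HeathBrown1994SelmerCongruentII, Appendix (Monsky), typescript p. 41 L20–L36] -/
theorem monskySelmerRankEven_pair_eq_one_of_card_eight {p q : ℕ} (hp : p.Prime) (hq : q.Prime) (hp2 : p ≠ 2)
    (hq2 : q ≠ 2) (hne : p ≠ q) (h8 : Nat.card ((congruentNumberCurve (2 * (p * q))).selmerGroup 2) = 8) :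
    monskySelmerRankEven ![p, q] = 1 := by
  have ht : ∀ i, (![p, q] i).Prime := fun i => by fin_cases i <;> assumption
  have ht2 : ∀ i, (![p, q] i) ≠ 2 := fun i => by fin_cases i <;> assumption
  have hinj : Function.Injective ![p, q] := by
    intro i j hij
    fin_cases i <;> fin_cases j
    · rfl
    · exact absurd hij hne
    · exact absurd hij.symm hne
    · rfl
  have key : ∀ {M : ℕ}, 2 * (∏ i, (![p, q] : Fin 2 → ℕ) i) = M →
      Nat.card ((congruentNumberCurve M).selmerGroup 2) = 2 ^ (2 + monskySelmerRankEven ![p, q]) := by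
    intro M hM
    subst hM
    exact CongruentNumberEvenMonskySelmerExact.card_selmerGroup_two_eq_pow ht ht2 hinj
  have hprod : 2 * (∏ i, (![p, q] : Fin 2 → ℕ) i) = 2 * (p * q) := by rw [Fin.prod_univ_two]; rfl
  have h' : 2 ^ (2 + monskySelmerRankEven ![p, q]) = 2 ^ 3 :=
    ((key hprod).symm.trans h8).trans (by norm_num)
  have := Nat.pow_right_injective le_rfl h'
  omega

/-! ## §2 The characterisation, shape by shape -/

/-- **One odd prime: `p ∈ Cor. 5.15 ⟺ #Sel⁽²⁾(E_p/ℚ) = 8`** (Heath-Brown's table `16, 4, 8, 8`: exactly `p ≡ 5, 7 (mod 8)`).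
[cite: Monsky1990MockHeegner, Cor. 5.15 (1) (p. 66), Remark (2) (p. 67)] [cite: HeathBrown1994SelmerCongruentII, §1 typescript p. 6 L26–L28] -/
theorem isCor515Family_prime_iff {p : ℕ} (hp : p.Prime) (hp2 : p ≠ 2) :
    IsCor515Family p ↔ Nat.card ((congruentNumberCurve p).selmerGroup 2) = 8 := by
  refine ⟨card_selmerGroup_two_eq_eight_of_isCor515Family, fun h8 => ?_⟩
  rw [card_selmerGroup_two_congruentNumberCurve_prime hp hp2] at h8
  have hodd : p % 2 = 1 := Nat.odd_iff.mp (hp.odd_of_ne_two hp2)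
  split_ifs at h8 with h1 h3
  · norm_num at h8
  · norm_num at h8
  · exact Or.inl ⟨hp, by omega⟩

/-- **Twice an odd prime: `2p ∈ Cor. 5.15 ⟺ #Sel⁽²⁾(E_{2p}/ℚ) = 8`** (the table `16, 8, 4, 8`: exactly `p ≡ 3, 7 (mod 8)`).
[cite: Monsky1990MockHeegner, Cor. 5.15 (1) (p. 66), Remark (2) (p. 67)] [cite: HeathBrown1994SelmerCongruentII, §1 typescript p. 5 L40–L44] -/
theorem isCor515Family_two_mul_prime_iff {p : ℕ} (hp : p.Prime) (hp2 : p ≠ 2) :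
    IsCor515Family (2 * p) ↔ Nat.card ((congruentNumberCurve (2 * p)).selmerGroup 2) = 8 := by
  refine ⟨card_selmerGroup_two_eq_eight_of_isCor515Family, fun h8 => ?_⟩
  rw [card_selmerGroup_two_congruentNumberCurve_two_mul_prime hp hp2] at h8
  have hodd : p % 2 = 1 := Nat.odd_iff.mp (hp.odd_of_ne_two hp2)
  split_ifs at h8 with h1 h5
  · norm_num at h8
  · norm_num at h8
  · exact Or.inr (Or.inl ⟨p, hp, by omega, rfl⟩)

/-- **Two odd primes: `pq ∈ Cor. 5.15 ⟺ #Sel⁽²⁾(E_{pq}/ℚ) = 8`.** `⟸`: `s(pq) = 1` is odd, so `pq ≡ 5, 7 (mod 8)` by Monsky's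
parity theorem (no prime `≡ 1` paired with a `≡ 1, 3`…: the residues are `{3, 5}, {3, 7}, {1, 5}, {1, 7}`), and the odd pair table
excludes `(p₁/q) = +1` (the exceptional rows `s = 3`). [cite: Monsky1990MockHeegner, Cor. 5.15 (2)–(3) (p. 66), Remarks (1)–(2) (pp. 66–67)]
[cite: HeathBrown1994SelmerCongruentII, Appendix (Monsky), typescript p. 38 L5–L7 and p. 39 L10–L33] [cite: IrelandRosen1990, Ch. 5 §2 Thm. 1] -/
theorem isCor515Family_mul_iff {p q : ℕ} (hp : p.Prime) (hq : q.Prime) (hp2 : p ≠ 2) (hq2 : q ≠ 2) (hne : p ≠ q) :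
    IsCor515Family (p * q) ↔ Nat.card ((congruentNumberCurve (p * q)).selmerGroup 2) = 8 := by
  refine ⟨card_selmerGroup_two_eq_eight_of_isCor515Family, fun h8 => ?_⟩
  have ht : ∀ i, (![p, q] i).Prime := fun i => by fin_cases i <;> assumption
  have ht2 : ∀ i, (![p, q] i) ≠ 2 := fun i => by fin_cases i <;> assumption
  have hinj : Function.Injective ![p, q] := by
    intro i j hij
    fin_cases i <;> fin_cases j
    · rfl
    · exact absurd hij hne
    · exact absurd hij.symm hne
    · rfl
  have hs := monskySelmerRankOdd_pair_eq_one_of_card_eight hp hq hp2 hq2 hne h8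
  -- parity: `s = 1` is odd, so `pq ≡ 5, 7 (mod 8)`
  have hpar := even_monskySelmerRankOdd_iff ![p, q] ht ht2 hinj
  rw [Fin.prod_univ_two] at hpar
  simp only [Matrix.cons_val_zero, Matrix.cons_val_one] at hpar
  have hnot : ¬ ((p * q) % 8 = 1 ∨ (p * q) % 8 = 3) := fun h => by
    have := hpar.mpr h
    rw [hs] at this
    exact absurd this (by decide)
  have hpodd : p % 2 = 1 := Nat.odd_iff.mp (hp.odd_of_ne_two hp2)
  have hqodd : q % 2 = 1 := Nat.odd_iff.mp (hq.odd_of_ne_two hq2)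
  have hpq8 : (p * q) % 8 = 5 ∨ (p * q) % 8 = 7 := by
    have : (p * q) % 2 = 1 := by rw [Nat.mul_mod, hpodd, hqodd]
    omega
  -- the table: not (`(q/p) = +1` with a prime `≡ 1 (mod 8)`)
  have htab := (monskySelmerRankOdd_pair_eq_one_iff ![p, q] ht ht2 hinj
    (by simpa only [Matrix.cons_val_zero, Matrix.cons_val_one] using hpq8)).mp hs
  simp only [Matrix.cons_val_zero, Matrix.cons_val_one] at htab
  have hprod : (p * q) % 8 = (p % 8) * (q % 8) % 8 := Nat.mul_mod _ _ _
  have hr0 : p % 8 = 1 ∨ p % 8 = 3 ∨ p % 8 = 5 ∨ p % 8 = 7 := by omega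
  have hr1 : q % 8 = 1 ∨ q % 8 = 3 ∨ q % 8 = 5 ∨ q % 8 = 7 := by omega
  -- `(q/p) = −1` when `p ≡ 1 (mod 8)`; `(p/q) = −1` when `q ≡ 1 (mod 8)`
  have hJ1 : p % 8 = 1 → jacobiSym p q = -1 := by
    intro h1
    have hqp : jacobiSym q p = -1 := by
      rcases jacobiSym_eq_one_or_eq_neg_one_of_prime_ne hq hp hne.symm with h | h
      · exact absurd ⟨h, Or.inl h1⟩ htab
      · exact h
    rwa [jacobiSym.quadratic_reciprocity_one_mod_four' (hq.odd_of_ne_two hq2) (by omega : p % 4 = 1)] at hqp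
  have hJ2 : q % 8 = 1 → jacobiSym q p = -1 := by
    intro h1
    rcases jacobiSym_eq_one_or_eq_neg_one_of_prime_ne hq hp hne.symm with h | h
    · exact absurd ⟨h, Or.inr h1⟩ htab
    · exact h
  rcases hr0 with h0 | h0 | h0 | h0 <;> rcases hr1 with h1 | h1 | h1 | h1 <;>
    simp only [h0, h1] at hprod <;> norm_num at hprod <;>
    first
    | (exfalso; omega)
    | skip
  · -- (1, 5)
    exact Or.inr (Or.inr (Or.inr (Or.inr (Or.inl ⟨p, q, hp, hq, h0, Or.inl h1, hJ1 h0, rfl⟩))))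
  · -- (1, 7)
    exact Or.inr (Or.inr (Or.inr (Or.inr (Or.inl ⟨p, q, hp, hq, h0, Or.inr h1, hJ1 h0, rfl⟩))))
  · -- (3, 5)
    exact Or.inr (Or.inr (Or.inl ⟨p, q, hp, hq, h0, Or.inr h1, rfl⟩))
  · -- (3, 7)
    exact Or.inr (Or.inr (Or.inl ⟨p, q, hp, hq, h0, Or.inl h1, rfl⟩))
  · -- (5, 1)
    exact Or.inr (Or.inr (Or.inr (Or.inr (Or.inl ⟨q, p, hq, hp, h1, Or.inl h0, hJ2 h1, mul_comm p q⟩))))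
  · -- (5, 3)
    exact Or.inr (Or.inr (Or.inl ⟨q, p, hq, hp, h1, Or.inr h0, mul_comm p q⟩))
  · -- (7, 1)
    exact Or.inr (Or.inr (Or.inr (Or.inr (Or.inl ⟨q, p, hq, hp, h1, Or.inr h0, hJ2 h1, mul_comm p q⟩))))
  · -- (7, 3)
    exact Or.inr (Or.inr (Or.inl ⟨q, p, hq, hp, h1, Or.inl h0, mul_comm p q⟩))

/-- **Twice two odd primes: `2pq ∈ Cor. 5.15 ⟺ #Sel⁽²⁾(E_{2pq}/ℚ) = 8`.** `⟸`: `s(2pq) = 1` is odd, so `pq ≡ 3 (mod 4)` by Monsky's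
parity theorem (one prime `≡ 1 (mod 4)`, the other `≡ 3 (mod 4)`); a prime `≡ 1 (mod 8)` with symbol `+1` would give `s = 3`.
[cite: Monsky1990MockHeegner, Cor. 5.15 (2)–(3) (p. 66), Remarks (1)–(2) (pp. 66–67)]
[cite: HeathBrown1994SelmerCongruentII, Appendix (Monsky), typescript p. 38 L5–L7 and p. 41 L20–L36] -/
theorem isCor515Family_two_mul_mul_iff {p q : ℕ} (hp : p.Prime) (hq : q.Prime) (hp2 : p ≠ 2) (hq2 : q ≠ 2)
    (hne : p ≠ q) :
    IsCor515Family (2 * (p * q)) ↔ Nat.card ((congruentNumberCurve (2 * (p * q))).selmerGroup 2) = 8 := by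
  refine ⟨card_selmerGroup_two_eq_eight_of_isCor515Family, fun h8 => ?_⟩
  have ht : ∀ i, (![p, q] i).Prime := fun i => by fin_cases i <;> assumption
  have ht2 : ∀ i, (![p, q] i) ≠ 2 := fun i => by fin_cases i <;> assumption
  have hinj : Function.Injective ![p, q] := by
    intro i j hij
    fin_cases i <;> fin_cases j
    · rfl
    · exact absurd hij hne
    · exact absurd hij.symm hne
    · rfl
  have hs := monskySelmerRankEven_pair_eq_one_of_card_eight hp hq hp2 hq2 hne h8
  -- parity: `s = 1` is odd, so `pq ≡ 3 (mod 4)`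
  have hpar := even_monskySelmerRankEven_iff ![p, q] ht ht2 hinj
  rw [Fin.prod_univ_two] at hpar
  simp only [Matrix.cons_val_zero, Matrix.cons_val_one] at hpar
  have hnot : ¬ ((p * q) % 4 = 1) := fun h => by
    have := hpar.mpr h
    rw [hs] at this
    exact absurd this (by decide)
  have hpodd : p % 2 = 1 := Nat.odd_iff.mp (hp.odd_of_ne_two hp2)
  have hqodd : q % 2 = 1 := Nat.odd_iff.mp (hq.odd_of_ne_two hq2)
  have hprod : (p * q) % 4 = (p % 4) * (q % 4) % 4 := Nat.mul_mod _ _ _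
  have hr0 : p % 4 = 1 ∨ p % 4 = 3 := by omega
  have hr1 : q % 4 = 1 ∨ q % 4 = 3 := by omega
  rcases hr0 with h0 | h0 <;> rcases hr1 with h1 | h1 <;> simp only [h0, h1] at hprod <;> norm_num at hprod <;>
    first
    | (exfalso; exact hnot hprod)
    | skip
  · -- `p ≡ 1 (mod 4)`, `q ≡ 3 (mod 4)`
    rcases (show p % 8 = 1 ∨ p % 8 = 5 by omega) with hp8 | hp8
    · have hj : jacobiSym p q = -1 := by
        rcases jacobiSym_eq_one_or_eq_neg_one_of_prime_ne hp hq hne with h | h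
        · have := (monskySelmerRankEven_one_pair_of_jacobiSym_eq_one hp hq hp8 h1 h).1
          omega
        · exact h
      exact Or.inr (Or.inr (Or.inr (Or.inr (Or.inr ⟨p, q, hp, hq, hp8, by omega, hj, rfl⟩))))
    · exact Or.inr (Or.inr (Or.inr (Or.inl ⟨p, q, hp, hq, hp8, by omega, rfl⟩)))
  · -- `p ≡ 3 (mod 4)`, `q ≡ 1 (mod 4)`: the swapped tuple
    rcases (show q % 8 = 1 ∨ q % 8 = 5 by omega) with hq8 | hq8
    · have hj : jacobiSym q p = -1 := by
        rcases jacobiSym_eq_one_or_eq_neg_one_of_prime_ne hq hp hne.symm with h | h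
        · have := (monskySelmerRankEven_one_pair_of_jacobiSym_eq_one hq hp hq8 h0 h).2
          omega
        · exact h
      exact Or.inr (Or.inr (Or.inr (Or.inr (Or.inr ⟨q, p, hq, hp, hq8, by omega, hj, by rw [mul_comm p q]⟩))))
    · exact Or.inr (Or.inr (Or.inr (Or.inl ⟨q, p, hq, hp, hq8, by omega, by rw [mul_comm p q]⟩)))

/-! ## §3 The characterisation: Cor. 5.15 = the `#Sel⁽²⁾ = 8` locus with at most two odd prime factors -/

/-- **MONSKY'S REMARK (2), THE `N`-SIDE OF «PRECISELY», AS A KERNEL THEOREM: for `N` a product of at most two distinct odd primes,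
possibly times `2`, `N` is in one of Cor. 5.15's twelve families ⟺ `#Sel⁽²⁾(E_N/ℚ) = 8` («`S̄ = ℤ/2`»).** In particular the twelve
families are EXACTLY the `s(N) = 1` locus on `ω_odd(N) ≤ 2`; the root-number class `N ≡ 5, 6, 7 (mod 8)` is forced by Monsky's
parity theorem, the symbol conditions by the exceptional rows `s = 3`. UNCONDITIONAL.
[cite: Monsky1990MockHeegner, Cor. 5.15 (p. 66), Remarks (1)–(2) (pp. 66–67)]
[cite: HeathBrown1994SelmerCongruentII, §1 typescript p. 6 L26–L28; Appendix (Monsky) p. 38 L5–L7, pp. 39–41] -/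
theorem isCor515Family_iff_card_selmerGroup_two_eq_eight {N : ℕ}
    (hshape : (∃ p : ℕ, p.Prime ∧ p ≠ 2 ∧ (N = p ∨ N = 2 * p)) ∨
      (∃ p q : ℕ, p.Prime ∧ q.Prime ∧ p ≠ 2 ∧ q ≠ 2 ∧ p ≠ q ∧ (N = p * q ∨ N = 2 * (p * q)))) :
    IsCor515Family N ↔ Nat.card ((congruentNumberCurve N).selmerGroup 2) = 8 := by
  rcases hshape with ⟨p, hp, hp2, rfl | rfl⟩ | ⟨p, q, hp, hq, hp2, hq2, hne, rfl | rfl⟩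
  · exact isCor515Family_prime_iff hp hp2
  · exact isCor515Family_two_mul_prime_iff hp hp2
  · exact isCor515Family_mul_iff hp hq hp2 hq2 hne
  · exact isCor515Family_two_mul_mul_iff hp hq hp2 hq2 hne

/-- **On the `#Sel⁽²⁾ = 8` locus with at most two odd prime factors: `N` congruent ⟺ `Ш(E_N)[2^∞] = 0`**, unconditionally — so
on Cor. 5.15's families Monsky's «rank exactly one» is the same statement as «`N` is a congruent number» (and the only way
`Ш(E_N)[2^∞]` can vanish). [cite: Monsky1990MockHeegner, Remark (2) (p. 67)] [cite: TopYui2008Congruent, Prop. 3.3 (i) ⟺ (iv)]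
[cite: SilvermanAEC2009, Thm. X.4.2] -/
theorem isCongruentNumber_iff_primaryComponent_sha_two_eq_bot_of_card_selmerGroup_two_eq_eight_shape {N : ℕ}
    (hshape : (∃ p : ℕ, p.Prime ∧ p ≠ 2 ∧ (N = p ∨ N = 2 * p)) ∨
      (∃ p q : ℕ, p.Prime ∧ q.Prime ∧ p ≠ 2 ∧ q ≠ 2 ∧ p ≠ q ∧ (N = p * q ∨ N = 2 * (p * q))))
    (h8 : Nat.card ((congruentNumberCurve N).selmerGroup 2) = 8) :
    haveI := isElliptic_congruentNumberCurve ((isCor515Family_iff_card_selmerGroup_two_eq_eight hshape).mpr h8).ne_zero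
    IsCongruentNumber N ↔ AddCommGroup.primaryComponent (congruentNumberCurve N).sha 2 = ⊥ :=
  isCongruentNumber_iff_primaryComponent_sha_two_eq_bot_of_isCor515Family
    ((isCor515Family_iff_card_selmerGroup_two_eq_eight hshape).mpr h8)

end Summit.BirchSwinnertonDyer.Rank1Residual.P2

end
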